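/-
Copyright (c) 2026 the pub-hodgecm-mathlib formalisation cell (harness21).  Prover seat hodgecm-mathlib-B-p14 (g33), 2026-09-01.  Road «W′» = «R1LL-WILD»
(architect A-p16 (g28) RULING A-37, socket (Ψ1) «unfolding into `T̃`-shells on `U_w`»; (W′0) A-p12 (g19) b7a6e0b9 §B2 ∕ §E3): the ALL-COSET unfolding of an
integral over an open subgroup, its orbital form for a GENERAL test function (no support condition), and the vertex ∕ shell readings.
-/
import Literature.GroupTheory.FixedPointsShellValueLaw          -- ★ p843939 (this seat): `conj_apply_eq_conj_apply_rep_of_act_eq_of_commute`; via ★ p843911 `exists_equiv_quotient_orbitMap`, `act_apply_eq_act_apply_iff_inv_mul_mem`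
import Mathlib.MeasureTheory.Group.Integral
import Mathlib.MeasureTheory.Measure.Haar.Unique
import Mathlib.MeasureTheory.Integral.Bochner.Set
import HarnessLib

/-!
# The all-coset unfolding `∫_G F dν = Σ_{q ∈ G ⧸ K} ∫_K F(q.out k) dν(k)` over an open subgroup, and the orbital integral of a GENERAL test function
# as a sum over the vertices ∕ shells of a transitive action: `∫_G f(y⁻¹ γ y) dν(y) = Σ_i #{x | d x = i} • f̄_K(r_i⁻¹ γ r_i)`

Topic `NumberTheory/Automorphic`; namespace `Literature.NumberTheory.Automorphic`.  THEOREMS ONLY (no definition, no instance, no notation, no named fact, no `sorry`);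
Mathlib + ★ `Literature.GroupTheory.FixedPoints{OrbitMapTransport,ShellValueLaw}`; kernel lane.  Cell `pub/hodgecm-mathlib`, crux H413 = stmt-HodgeConjecture-24833; road «W′» =
«R1LL-WILD» (LEAD F0P3a-plan (g10) T9-25; architect A-p16 (g28) RULING A-37 socket **(Ψ1)**; assembler p04 (g14)).  This is the GENERAL-`f` companion of ★ I-3
`OrbitalIntegralFixedPointWeighted` (F0P2-p01; `supp f ⊆ K`, only FIXED cosets contribute) and of this seat's ★ (W′2) vertex readings: (W′0) §E3 «instead of pieces the END
can use the plain all-coset unfolding `∫_U F dν = Σ_{x ∈ U⧸K_U} ∫_{K_U} F(u_x k) dk` (no support condition) … + (W′1) to group `U⧸K_U = X⁰` into `T̃`-shells» — no such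
unfolding was ★ (`rg` 11:45Z), so it is typed here.
HONEST LABEL: HC_CM is proved only modulo the cell's remaining named inputs (hLiu418, h413) until rung 0 closes; generic measure bookkeeping, print cited for orientation.

THE MATHEMATICS [LabesseLanglands1979 §2 p. 8; Labesse2024 Prop. 0.0.10–0.0.11 (via (W′0)); Rogawski1990 §4.9 p. 54; Kottwitz1986 §3].  `G` a topological group with a
LEFT-invariant measure `ν`, `K ≤ G` an OPEN subgroup.  The left cosets `q.out·K` (`q ∈ G ⧸ K`) partition `G` into open sets, so for an integrable `F` whose support meets
only the cosets in a finite set `S`: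
  (§1) `∫_G F dν = Σ_{q ∈ S} ∫_K F(q.out k) dν(k)`.
For the orbital integrand `F(y) = f(y⁻¹ γ y)` of ANY test function `f` the inner integral is the `K`-AVERAGE `f̄_K(y) := ∫_K f(k⁻¹ y k) dν(k)` at `y = q.out⁻¹ γ q.out` (§2), and
`f̄_K` is invariant under `K`-conjugation (§2, left-invariance only).  Along the orbit map of a transitive action with `K = Stab(x₀)` (★ `FixedPointsOrbitMapTransport`) the
coset sum becomes a sum over VERTICES, and if every vertex `x` in the finite support set is `act (t · r_{d x}) x₀` with `t γ = γ t` (a SHELL DECOMPOSITION through the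
centraliser — (W′1) ★ `SLTwoTreeQuadraticTorusShellDecomposition` for the elliptic torus on the tree of `SL₂`; fixedness is NOT needed, ★ `conj_apply_eq_conj_apply_rep…`)
then `f̄_K(g⁻¹ γ g) = f̄_K(r_{d x}⁻¹ γ r_{d x})` at `x = act g x₀`, whence (§3) the SHELL SUM
  `∫_G f(y⁻¹ γ y) dν(y) = Σ_{i ∈ s} #{x ∈ SV | d x = i} • f̄_K(r_i⁻¹ γ r_i)`
— Labesse–Langlands' `∫_{T̃∖G̃} f(x̃⁻¹ t x̃) dx̃ = Σ_m C_m ∫_{K̃} f(k⁻¹ α_m⁻¹ t α_m k) dk` (`C_m = 2q^m` at a ramified place; (W′0) §B2), with an ARBITRARY shell index type `ι` (so the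
assembler may index `T̃`-shells `m`, or `Z_U(t)`-orbits = half-shells `(m, ±)` per (W′0) §B1).  The `∫ f(y γ y⁻¹)` form follows under inversion invariance (unimodular `G`).

* §1 `mem_preimage_out_inv_mul_iff`, `eq_sum_indicator_coset`, **`integral_eq_sum_setIntegral_mul_left`**.
* §2 **`integral_conj_inv_eq_sum_setIntegral_conj`**, `integral_conj_eq_sum_setIntegral_conj` (`[ν.IsInvInvariant]`), `setIntegral_conj_conj_eq` (`f̄_K` is `Ad K`-invariant).
* §3 `finsum_mem_eq_sum_ncard_fiber_smul_of_mapsTo` (regrouping, any index type), **`integral_conj_inv_eq_finsum_vertices_of_vertexAction`**,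
  **`integral_conj_inv_eq_sum_ncard_shell_smul_of_vertexAction`** (+ the `y γ y⁻¹` twins).
* §4 (ED. 2) UNIMODULAR BOOKKEEPING: `isInvInvariant_of_isHaarMeasure_of_isMulRightInvariant` (a Haar measure that is also right-invariant is inversion-invariant —
  second-countable locally compact group; Haar uniqueness), and the `y γ y⁻¹` heads under EXACTLY the rank-one letter's instances `[ν.IsHaarMeasure] [ν.IsMulRightInvariant]`:
  `integral_conj_eq_finsum_vertices_of_vertexAction_haar`, `integral_conj_eq_sum_ncard_shell_smul_of_vertexAction_haar`.
* §5 (ED. 3) THE DIFFERENCE FORM for a pair `γ, γ′` sharing the support set and the shell index (`O(γ,f) − O(γ′,f)` = the LHS of the (γ) layer's `hO`,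
  ★ `rankOneUnstable_core_of_shellWindow`): `integral_conj_sub_integral_conj_eq_sum_ncard_shell_smul_sub_of_vertexAction_haar`.

What is NOT here: the `H_v = U(Φ₂)_v × U(Φ₁)_v` ∕ `ρ_w` dress (one `exact` with `act := fun h => rhoVertexActPlace … (E₂ h.1)`, as ★ `RankOneKappaOrbitalUnfoldingTree`;
cut to the assembler's (γ)-layer tokens), the shell counts `C_m` ((W′1)), the per-shell values ((W′3)), integrability of the orbital integrand (a binder).

## References
* [LabesseLanglands1979] J.-P. Labesse, R. P. Langlands, *L-indistinguishability for SL(2)*, Canad. J. Math. 31 (1979): §2 p. 8.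
* [Rogawski1990] J. D. Rogawski, *Automorphic Representations of Unitary Groups in Three Variables*, Ann. of Math. Stud. 123 (1990): §4.9 p. 54.
* [Kottwitz1986] R. E. Kottwitz, *Base change for unit elements of Hecke algebras*, Compositio Math. 60 (1986): §3.
* [Folland1995] G. B. Folland, *A Course in Abstract Harmonic Analysis* (1995): §2.6 (2.52) (invariance of Haar integrals), §2.7 (homogeneous spaces).
-/

set_option autoImplicit false

noncomputable section

open MeasureTheory Measure Topology Filter Set Function MulAction
open Literature.GroupTheory
open scoped ENNReal NNReal Pointwise

namespace Literature.NumberTheory.Automorphic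

/-! ## §1 The all-coset unfolding over an open subgroup -/

section Coset

variable {G : Type*} [Group G] (K : Subgroup G) {E : Type*}

/-- Membership in the left coset `q` as a preimage of `K`: `q.out⁻¹ g ∈ K ↔ gK = q`. [cite: Folland1995, §2.7] -/
theorem mem_preimage_out_inv_mul_iff (q : G ⧸ K) (g : G) :
    g ∈ (fun x : G => q.out⁻¹ * x) ⁻¹' (K : Set G) ↔ (QuotientGroup.mk g : G ⧸ K) = q := by
  rw [Set.mem_preimage, SetLike.mem_coe, ← QuotientGroup.eq, QuotientGroup.out_eq']
  exact eq_comm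

/-- **Pointwise coset decomposition**: if `F` vanishes off the cosets in the finite set `S`, then `F = Σ_{q ∈ S} 1_{q.out·K} · F`. [cite: Folland1995, §2.7] -/
theorem eq_sum_indicator_coset [AddCommMonoid E] (F : G → E) (S : Finset (G ⧸ K)) (hS : ∀ g : G, F g ≠ 0 → (QuotientGroup.mk g : G ⧸ K) ∈ S) (g : G) :
    F g = ∑ q ∈ S, ((fun x : G => q.out⁻¹ * x) ⁻¹' (K : Set G)).indicator F g := by
  classical
  by_cases hg : (QuotientGroup.mk g : G ⧸ K) ∈ S
  · rw [Finset.sum_eq_single_of_mem _ hg fun q _ hne => ?_]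
    · rw [indicator_of_mem ((mem_preimage_out_inv_mul_iff K _ g).2 rfl)]
    · exact indicator_of_notMem (fun h => hne ((mem_preimage_out_inv_mul_iff K q g).1 h).symm) _
  · have hF : F g = 0 := by
      by_contra h
      exact hg (hS g h)
    rw [hF]
    refine (Finset.sum_eq_zero fun q hq => indicator_of_notMem (fun h => hg ?_) _).symm
    rw [(mem_preimage_out_inv_mul_iff K q g).1 h]
    exact hq

variable [TopologicalSpace G] [IsTopologicalGroup G] [MeasurableSpace G] [BorelSpace G] (ν : Measure G) [ν.IsMulLeftInvariant]
  [NormedAddCommGroup E] [NormedSpace ℝ E]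

/-- **THE ALL-COSET UNFOLDING OVER AN OPEN SUBGROUP**: for `K` open, `ν` left-invariant, `F` integrable and vanishing off the cosets in the finite set `S ⊆ G ⧸ K`,
`∫_G F dν = Σ_{q ∈ S} ∫_K F(q.out k) dν(k)` — the cosets `q.out·K` are disjoint open sets and `∫_{q.out·K} F = ∫_K F(q.out ·)` by left-invariance.  (No support-in-`K`
condition; the `supp ⊆ K`, fixed-cosets-only special case is ★ `integral_conj_eq_smul_finsum_fixedBy`.) [cite: Folland1995, §2.6 (2.52) and §2.7] [cite: Kottwitz1986, §3] -/
theorem integral_eq_sum_setIntegral_mul_left (hK : IsOpen (K : Set G)) (F : G → E) (hF : Integrable F ν) (S : Finset (G ⧸ K))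
    (hS : ∀ g : G, F g ≠ 0 → (QuotientGroup.mk g : G ⧸ K) ∈ S) :
    ∫ g, F g ∂ν = ∑ q ∈ S, ∫ k in (K : Set G), F (q.out * k) ∂ν := by
  have hAm : ∀ q : G ⧸ K, MeasurableSet ((fun x : G => q.out⁻¹ * x) ⁻¹' (K : Set G)) := fun q =>
    (hK.preimage (continuous_const_mul _)).measurableSet
  calc ∫ g, F g ∂ν = ∫ g, ∑ q ∈ S, ((fun x : G => q.out⁻¹ * x) ⁻¹' (K : Set G)).indicator F g ∂ν :=
        integral_congr_ae (Filter.Eventually.of_forall (eq_sum_indicator_coset K F S hS))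
    _ = ∑ q ∈ S, ∫ g, ((fun x : G => q.out⁻¹ * x) ⁻¹' (K : Set G)).indicator F g ∂ν := integral_finsetSum _ fun q _ => hF.indicator (hAm q)
    _ = ∑ q ∈ S, ∫ k in (K : Set G), F (q.out * k) ∂ν := Finset.sum_congr rfl fun q _ => by
        have hind : (fun x : G => ((fun y : G => q.out⁻¹ * y) ⁻¹' (K : Set G)).indicator F (q.out * x)) =
            (K : Set G).indicator fun k : G => F (q.out * k) := by
          funext x
          by_cases hx : x ∈ (K : Set G)
          · rw [indicator_of_mem hx, indicator_of_mem]
            rw [Set.mem_preimage, inv_mul_cancel_left]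
            exact hx
          · rw [indicator_of_notMem hx, indicator_of_notMem]
            rw [Set.mem_preimage, inv_mul_cancel_left]
            exact hx
        rw [← integral_mul_left_eq_self (((fun x : G => q.out⁻¹ * x) ⁻¹' (K : Set G)).indicator F) q.out, hind,
          integral_indicator hK.measurableSet]

/-! ## §2 The orbital integral of a GENERAL test function as a coset sum of `K`-averages -/

/-- **`∫_G f(y⁻¹ γ y) dν(y) = Σ_{q ∈ S} ∫_K f(k⁻¹ (q.out⁻¹ γ q.out) k) dν(k)`** for ANY `f` with the orbital integrand integrable and supported on the cosets in `S`:
the inner integral is the `K`-average `f̄_K` of `f` at «`γ` read at the coset `q`». [cite: LabesseLanglands1979, §2 p. 8] [cite: Rogawski1990, §4.9 p. 54] [cite: Kottwitz1986, §3] -/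
theorem integral_conj_inv_eq_sum_setIntegral_conj (hK : IsOpen (K : Set G)) (γ : G) (f : G → E) (hF : Integrable (fun y : G => f (y⁻¹ * γ * y)) ν)
    (S : Finset (G ⧸ K)) (hS : ∀ y : G, f (y⁻¹ * γ * y) ≠ 0 → (QuotientGroup.mk y : G ⧸ K) ∈ S) :
    ∫ y, f (y⁻¹ * γ * y) ∂ν = ∑ q ∈ S, ∫ k in (K : Set G), f (k⁻¹ * (q.out⁻¹ * γ * q.out) * k) ∂ν := by
  rw [integral_eq_sum_setIntegral_mul_left K ν hK (fun y : G => f (y⁻¹ * γ * y)) hF S hS]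
  refine Finset.sum_congr rfl fun q _ => ?_
  congr 1
  funext k
  congr 1
  group

/-- **The `y γ y⁻¹` form** (inversion-invariant `ν`, e.g. any Haar measure on a unimodular group): `∫_G f(y γ y⁻¹) dν(y) = Σ_{q ∈ S} ∫_K f(k⁻¹ (q.out⁻¹ γ q.out) k) dν(k)`.
[cite: LabesseLanglands1979, §2 p. 8] [cite: Rogawski1990, §4.9 p. 54] -/
theorem integral_conj_eq_sum_setIntegral_conj [ν.IsInvInvariant] (hK : IsOpen (K : Set G)) (γ : G) (f : G → E)
    (hF : Integrable (fun y : G => f (y⁻¹ * γ * y)) ν)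
    (S : Finset (G ⧸ K)) (hS : ∀ y : G, f (y⁻¹ * γ * y) ≠ 0 → (QuotientGroup.mk y : G ⧸ K) ∈ S) :
    ∫ y, f (y * γ * y⁻¹) ∂ν = ∑ q ∈ S, ∫ k in (K : Set G), f (k⁻¹ * (q.out⁻¹ * γ * q.out) * k) ∂ν := by
  rw [← integral_conj_inv_eq_sum_setIntegral_conj K ν hK γ f hF S hS, ← integral_inv_eq_self (fun y : G => f (y⁻¹ * γ * y)) ν]
  simp only [inv_inv]

/-- **The `K`-average is invariant under `K`-conjugation**: for `k₀ ∈ K`, `∫_K f(k⁻¹ (k₀ y k₀⁻¹) k) dν(k) = ∫_K f(k⁻¹ y k) dν(k)` (substitute `k ↦ k₀ k`; LEFT-invariance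
of `ν` only). [cite: Folland1995, §2.6 (2.52)] -/
theorem setIntegral_conj_conj_eq (hK : IsOpen (K : Set G)) (f : G → E) {k₀ : G} (hk₀ : k₀ ∈ K) (y : G) :
    ∫ k in (K : Set G), f (k⁻¹ * (k₀ * y * k₀⁻¹) * k) ∂ν = ∫ k in (K : Set G), f (k⁻¹ * y * k) ∂ν := by
  rw [← integral_indicator hK.measurableSet, ← integral_indicator hK.measurableSet,
    ← integral_mul_left_eq_self ((K : Set G).indicator fun k : G => f (k⁻¹ * (k₀ * y * k₀⁻¹) * k)) k₀]
  congr 1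
  funext x
  by_cases hx : x ∈ K
  · rw [indicator_of_mem (show k₀ * x ∈ (K : Set G) from K.mul_mem hk₀ hx), indicator_of_mem (show x ∈ (K : Set G) from hx)]
    congr 1
    group
  · rw [indicator_of_notMem (show k₀ * x ∉ (K : Set G) from fun h => hx ((Subgroup.mul_mem_cancel_left K hk₀).1 h)),
      indicator_of_notMem (show x ∉ (K : Set G) from hx)]

end Coset

/-! ## §3 The vertex and shell readings (no fixedness needed) -/

section Regroup

variable {W ι E : Type*} [AddCommMonoid E]

/-- **Regrouping a finite sum by an index with values in a finite set** (any index type; the `ℕ`-with-bound case is ★ `finsum_mem_eq_sum_ncard_fiber_smul`): if `val x = w (d x)`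
on a finite `S` and `d '' S ⊆ s`, then `Σᶠ_{x ∈ S} val x = Σ_{i ∈ s} #{x ∈ S | d x = i} • w i`. [cite: LabesseLanglands1979, §2 p. 8] -/
theorem finsum_mem_eq_sum_ncard_fiber_smul_of_mapsTo {S : Set W} (hS : S.Finite) (val : W → E) (d : W → ι) (s : Finset ι) (w : ι → E)
    (hval : ∀ x ∈ S, val x = w (d x)) (hs : ∀ x ∈ S, d x ∈ s) :
    ∑ᶠ x ∈ S, val x = ∑ i ∈ s, {x ∈ S | d x = i}.ncard • w i := by
  classical
  rw [finsum_mem_eq_finite_toFinset_sum _ hS]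
  have hfib : ∀ i, ({x ∈ S | d x = i}).ncard = (hS.toFinset.filter fun x => d x = i).card := fun i => by
    rw [Set.ncard_eq_toFinset_card _ (hS.subset fun x hx => hx.1)]
    congr 1
    ext x
    simp only [Finset.mem_filter, Set.Finite.mem_toFinset, Set.mem_setOf_eq]
  calc ∑ x ∈ hS.toFinset, val x
      = ∑ x ∈ hS.toFinset, w (d x) := Finset.sum_congr rfl fun x hx => hval x ((Set.Finite.mem_toFinset hS).1 hx)
    _ = ∑ i ∈ s, ∑ x ∈ hS.toFinset with d x = i, w (d x) :=
        (Finset.sum_fiberwise_of_maps_to (g := d) (fun x hx => hs x ((Set.Finite.mem_toFinset hS).1 hx)) _).symm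
    _ = ∑ i ∈ s, {x ∈ S | d x = i}.ncard • w i := by
        refine Finset.sum_congr rfl fun i _ => ?_
        rw [hfib i, ← Finset.sum_const]
        exact Finset.sum_congr rfl fun x hx => by rw [(Finset.mem_filter.1 hx).2]

end Regroup

section Vertex

variable {G : Type*} [Group G] [TopologicalSpace G] [IsTopologicalGroup G] [MeasurableSpace G] [BorelSpace G]
  (ν : Measure G) [ν.IsMulLeftInvariant] (K : Subgroup G)
  {E : Type*} [NormedAddCommGroup E] [NormedSpace ℝ E]
  {W : Type*} (act : G → W → W) (act_one : ∀ x : W, act 1 x = x) (act_mul : ∀ (g h : G) (x : W), act (g * h) x = act g (act h x))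
  {x₀ : W} (hV : ∀ x : W, ∃ g : G, act g x₀ = x) (hKv : ∀ g : G, g ∈ K ↔ act g x₀ = x₀) (γ : G)

include act_one act_mul hV hKv in
/-- **THE ORBITAL INTEGRAL OF A GENERAL `f` AS A SUM OVER VERTICES**: `K = Stab(x₀)` open, one orbit; `SV` a FINITE set of vertices carrying the support of the orbital
integrand (`f (y⁻¹ γ y) ≠ 0 → act y x₀ ∈ SV`), and a value law for the `K`-average at the vertices of `SV`
(`act g x₀ ∈ SV → ∫_K f(k⁻¹ (g⁻¹ γ g) k) = val (act g x₀)`): `∫_G f(y⁻¹ γ y) dν(y) = Σᶠ_{x ∈ SV} val x`. [cite: LabesseLanglands1979, §2 p. 8] [cite: Kottwitz1986, §3] -/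
theorem integral_conj_inv_eq_finsum_vertices_of_vertexAction (hK : IsOpen (K : Set G)) (f : G → E)
    (hF : Integrable (fun y : G => f (y⁻¹ * γ * y)) ν) {SV : Set W} (hSV : SV.Finite)
    (hsupp : ∀ y : G, f (y⁻¹ * γ * y) ≠ 0 → act y x₀ ∈ SV) (val : W → E)
    (hval : ∀ g : G, act g x₀ ∈ SV → ∫ k in (K : Set G), f (k⁻¹ * (g⁻¹ * γ * g) * k) ∂ν = val (act g x₀)) :
    ∫ y, f (y⁻¹ * γ * y) ∂ν = ∑ᶠ x ∈ SV, val x := by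
  classical
  obtain ⟨Φ, hΦ⟩ := exists_equiv_quotient_orbitMap K (fun g : G => act g x₀) (act_apply_eq_act_apply_iff_inv_mul_mem act act_one act_mul K hKv) hV
  have hΦout : ∀ q : G ⧸ K, Φ q = act q.out x₀ := equiv_quotient_orbitMap_apply_eq_apply_out K (fun g : G => act g x₀) Φ hΦ
  -- the finite set of cosets carrying the support
  let S : Finset (G ⧸ K) := hSV.toFinset.map Φ.symm.toEmbedding
  have hmemS : ∀ q : G ⧸ K, q ∈ S ↔ Φ q ∈ SV := fun q => by
    constructor
    · intro hq
      obtain ⟨x, hx, hxq⟩ := Finset.mem_map.1 hq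
      rw [← hxq, Equiv.toEmbedding_apply, Equiv.apply_symm_apply]
      exact (Set.Finite.mem_toFinset hSV).1 hx
    · intro hq
      exact Finset.mem_map.2 ⟨Φ q, (Set.Finite.mem_toFinset hSV).2 hq, by rw [Equiv.toEmbedding_apply, Equiv.symm_apply_apply]⟩
  have hS : ∀ y : G, f (y⁻¹ * γ * y) ≠ 0 → (QuotientGroup.mk y : G ⧸ K) ∈ S := fun y hy => by
    rw [hmemS, hΦ]
    exact hsupp y hy
  rw [integral_conj_inv_eq_sum_setIntegral_conj K ν hK γ f hF S hS]
  calc ∑ q ∈ S, ∫ k in (K : Set G), f (k⁻¹ * (q.out⁻¹ * γ * q.out) * k) ∂ν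
      = ∑ q ∈ S, val (Φ q) := Finset.sum_congr rfl fun q hq => by
        rw [hΦout]
        exact hval q.out (by rw [← hΦout]; exact (hmemS q).1 hq)
    _ = ∑ x ∈ hSV.toFinset, val x := by
        rw [Finset.sum_map]
        exact Finset.sum_congr rfl fun x _ => by rw [Equiv.toEmbedding_apply, Equiv.apply_symm_apply]
    _ = ∑ᶠ x ∈ SV, val x := (finsum_mem_eq_finite_toFinset_sum _ hSV).symm

include act_one act_mul hV hKv in
/-- **THE ORBITAL INTEGRAL OF A GENERAL `f` AS A SHELL SUM** (Labesse–Langlands' `Σ_m C_m · ∫_{K} f(k⁻¹ α_m⁻¹ t α_m k) dk`): with a shell index `d : W → ι`, representatives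
`r : ι → G`, a finite index window `s`, and the SHELL HYPOTHESIS «every vertex of `SV` is `act (t · r (d x)) x₀` with `t γ = γ t`» (fixedness NOT required):
`∫_G f(y⁻¹ γ y) dν(y) = Σ_{i ∈ s} #{x ∈ SV | d x = i} • ∫_K f(k⁻¹ (r_i⁻¹ γ r_i) k) dν(k)`. [cite: LabesseLanglands1979, §2 p. 8] [cite: Rogawski1990, §4.9 p. 54] [cite: Kottwitz1986, §3] -/
theorem integral_conj_inv_eq_sum_ncard_shell_smul_of_vertexAction (hK : IsOpen (K : Set G)) (f : G → E)
    (hF : Integrable (fun y : G => f (y⁻¹ * γ * y)) ν) {SV : Set W} (hSV : SV.Finite)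
    (hsupp : ∀ y : G, f (y⁻¹ * γ * y) ≠ 0 → act y x₀ ∈ SV) {ι : Type*} (d : W → ι) (r : ι → G) (s : Finset ι)
    (hshell : ∀ x ∈ SV, ∃ t : G, t * γ = γ * t ∧ act (t * r (d x)) x₀ = x) (hs : ∀ x ∈ SV, d x ∈ s) :
    ∫ y, f (y⁻¹ * γ * y) ∂ν = ∑ i ∈ s, {x ∈ SV | d x = i}.ncard • ∫ k in (K : Set G), f (k⁻¹ * ((r i)⁻¹ * γ * r i) * k) ∂ν := by
  rw [integral_conj_inv_eq_finsum_vertices_of_vertexAction ν K act act_one act_mul hV hKv γ hK f hF hSV hsupp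
    (fun x => ∫ k in (K : Set G), f (k⁻¹ * ((r (d x))⁻¹ * γ * r (d x)) * k) ∂ν) fun g hg => ?_]
  · exact finsum_mem_eq_sum_ncard_fiber_smul_of_mapsTo hSV _ d s (fun i => ∫ k in (K : Set G), f (k⁻¹ * ((r i)⁻¹ * γ * r i) * k) ∂ν)
      (fun _ _ => rfl) hs
  · obtain ⟨t, ht, hx⟩ := hshell _ hg
    exact conj_apply_eq_conj_apply_rep_of_act_eq_of_commute act act_one act_mul K hKv γ
      (fun y : G => ∫ k in (K : Set G), f (k⁻¹ * y * k) ∂ν) (fun k₀ hk₀ y => setIntegral_conj_conj_eq K ν hK f hk₀ y) ht hx.symm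

include act_one act_mul hV hKv in
/-- **The `y γ y⁻¹` shell sum** (inversion-invariant `ν`): `∫_G f(y γ y⁻¹) dν(y) = Σ_{i ∈ s} #{x ∈ SV | d x = i} • ∫_K f(k⁻¹ (r_i⁻¹ γ r_i) k) dν(k)`.
[cite: LabesseLanglands1979, §2 p. 8] [cite: Rogawski1990, §4.9 p. 54] -/
theorem integral_conj_eq_sum_ncard_shell_smul_of_vertexAction [ν.IsInvInvariant] (hK : IsOpen (K : Set G)) (f : G → E)
    (hF : Integrable (fun y : G => f (y⁻¹ * γ * y)) ν) {SV : Set W} (hSV : SV.Finite)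
    (hsupp : ∀ y : G, f (y⁻¹ * γ * y) ≠ 0 → act y x₀ ∈ SV) {ι : Type*} (d : W → ι) (r : ι → G) (s : Finset ι)
    (hshell : ∀ x ∈ SV, ∃ t : G, t * γ = γ * t ∧ act (t * r (d x)) x₀ = x) (hs : ∀ x ∈ SV, d x ∈ s) :
    ∫ y, f (y * γ * y⁻¹) ∂ν = ∑ i ∈ s, {x ∈ SV | d x = i}.ncard • ∫ k in (K : Set G), f (k⁻¹ * ((r i)⁻¹ * γ * r i) * k) ∂ν := by
  rw [← integral_conj_inv_eq_sum_ncard_shell_smul_of_vertexAction ν K act act_one act_mul hV hKv γ hK f hF hSV hsupp d r s hshell hs,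
    ← integral_inv_eq_self (fun y : G => f (y⁻¹ * γ * y)) ν]
  simp only [inv_inv]

end Vertex


/-! ## §4 Unimodular bookkeeping (ED. 2): the `y γ y⁻¹` heads under `[ν.IsHaarMeasure] [ν.IsMulRightInvariant]` -/

section Unimodular

variable {G : Type*} [Group G] [TopologicalSpace G] [IsTopologicalGroup G] [LocallyCompactSpace G] [SecondCountableTopology G]
  [MeasurableSpace G] [BorelSpace G]

/-- **A Haar measure that is also right-invariant is inversion-invariant** (second-countable locally compact group): `μ.inv` is left-invariant, hence `c • μ` by
uniqueness of Haar measure, and `c² = 1` because inversion is an involution.  (Mathlib has the abelian case `IsHaarMeasure.isInvInvariant_of_regular`; same proof.)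
[cite: Folland1995, §2.4] -/
theorem isInvInvariant_of_isHaarMeasure_of_isMulRightInvariant (μ : Measure G) [μ.IsHaarMeasure] [μ.IsMulRightInvariant] : μ.IsInvInvariant := by
  constructor
  let c : ℝ≥0∞ := haarScalarFactor μ.inv μ
  have hc : μ.inv = c • μ := isMulLeftInvariant_eq_smul μ.inv μ
  have h2 : map Inv.inv (map Inv.inv μ) = c ^ 2 • μ := by
    rw [← inv_def μ, hc, Measure.map_smul, ← inv_def μ, hc, smul_smul, pow_two]
  have μeq : μ = c ^ 2 • μ := by
    rw [map_map continuous_inv.measurable continuous_inv.measurable] at h2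
    simpa only [inv_involutive, Involutive.comp_self, Measure.map_id] using h2
  have K : TopologicalSpace.PositiveCompacts G := Classical.arbitrary _
  have h3 : c ^ 2 * μ K = 1 ^ 2 * μ K := by
    conv_rhs => rw [μeq]
    simp
  have h4 : c ^ 2 = 1 ^ 2 :=
    (ENNReal.mul_left_inj (measure_pos_of_nonempty_interior _ K.interior_nonempty).ne' K.isCompact.measure_lt_top.ne).1 h3
  have h5 : c = 1 := (ENNReal.pow_right_strictMono two_ne_zero).injective h4
  rw [hc, h5, one_smul]

variable (ν : Measure G) [ν.IsHaarMeasure] [ν.IsMulRightInvariant] (K : Subgroup G)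
  {E : Type*} [NormedAddCommGroup E] [NormedSpace ℝ E]
  {W : Type*} (act : G → W → W) (act_one : ∀ x : W, act 1 x = x) (act_mul : ∀ (g h : G) (x : W), act (g * h) x = act g (act h x))
  {x₀ : W} (hV : ∀ x : W, ∃ g : G, act g x₀ = x) (hKv : ∀ g : G, g ∈ K ↔ act g x₀ = x₀) (γ : G)

include act_one act_mul hV hKv in
/-- **`∫_G f(y γ y⁻¹) dν(y) = Σᶠ_{x ∈ SV} val x`** under the rank-one letter's instances (`ν` a Haar measure that is also right-invariant; inversion invariance by the
lemma above). [cite: LabesseLanglands1979, §2 p. 8] [cite: Kottwitz1986, §3] -/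
theorem integral_conj_eq_finsum_vertices_of_vertexAction_haar (hK : IsOpen (K : Set G)) (f : G → E)
    (hF : Integrable (fun y : G => f (y⁻¹ * γ * y)) ν) {SV : Set W} (hSV : SV.Finite)
    (hsupp : ∀ y : G, f (y⁻¹ * γ * y) ≠ 0 → act y x₀ ∈ SV) (val : W → E)
    (hval : ∀ g : G, act g x₀ ∈ SV → ∫ k in (K : Set G), f (k⁻¹ * (g⁻¹ * γ * g) * k) ∂ν = val (act g x₀)) :
    ∫ y, f (y * γ * y⁻¹) ∂ν = ∑ᶠ x ∈ SV, val x := by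
  haveI := isInvInvariant_of_isHaarMeasure_of_isMulRightInvariant ν
  rw [← integral_conj_inv_eq_finsum_vertices_of_vertexAction ν K act act_one act_mul hV hKv γ hK f hF hSV hsupp val hval,
    ← integral_inv_eq_self (fun y : G => f (y⁻¹ * γ * y)) ν]
  simp only [inv_inv]

include act_one act_mul hV hKv in
/-- **`∫_G f(y γ y⁻¹) dν(y) = Σ_{i ∈ s} #{x ∈ SV | d x = i} • ∫_K f(k⁻¹ (r_i⁻¹ γ r_i) k) dν(k)`** under the rank-one letter's instances (`[ν.IsHaarMeasure] [ν.IsMulRightInvariant]`).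
[cite: LabesseLanglands1979, §2 p. 8] [cite: Rogawski1990, §4.9 p. 54] -/
theorem integral_conj_eq_sum_ncard_shell_smul_of_vertexAction_haar (hK : IsOpen (K : Set G)) (f : G → E)
    (hF : Integrable (fun y : G => f (y⁻¹ * γ * y)) ν) {SV : Set W} (hSV : SV.Finite)
    (hsupp : ∀ y : G, f (y⁻¹ * γ * y) ≠ 0 → act y x₀ ∈ SV) {ι : Type*} (d : W → ι) (r : ι → G) (s : Finset ι)
    (hshell : ∀ x ∈ SV, ∃ t : G, t * γ = γ * t ∧ act (t * r (d x)) x₀ = x) (hs : ∀ x ∈ SV, d x ∈ s) :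
    ∫ y, f (y * γ * y⁻¹) ∂ν = ∑ i ∈ s, {x ∈ SV | d x = i}.ncard • ∫ k in (K : Set G), f (k⁻¹ * ((r i)⁻¹ * γ * r i) * k) ∂ν := by
  haveI := isInvInvariant_of_isHaarMeasure_of_isMulRightInvariant ν
  exact integral_conj_eq_sum_ncard_shell_smul_of_vertexAction ν K act act_one act_mul hV hKv γ hK f hF hSV hsupp d r s hshell hs

end Unimodular


/-! ## §5 (ED. 3) The difference form `O(γ, f) − O(γ′, f)` (the LHS of the (γ) layer's `hO`) -/

section Difference

variable {G : Type*} [Group G] [TopologicalSpace G] [IsTopologicalGroup G] [LocallyCompactSpace G] [SecondCountableTopology G]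
  [MeasurableSpace G] [BorelSpace G]
  (ν : Measure G) [ν.IsHaarMeasure] [ν.IsMulRightInvariant] (K : Subgroup G)
  {E : Type*} [NormedAddCommGroup E] [NormedSpace ℝ E]
  {W : Type*} (act : G → W → W) (act_one : ∀ x : W, act 1 x = x) (act_mul : ∀ (g h : G) (x : W), act (g * h) x = act g (act h x))
  {x₀ : W} (hV : ∀ x : W, ∃ g : G, act g x₀ = x) (hKv : ∀ g : G, g ∈ K ↔ act g x₀ = x₀)

include act_one act_mul hV hKv in
/-- **THE DIFFERENCE OF TWO ORBITAL INTEGRALS AS ONE SHELL SUM**: for `γ`, `γ′` (e.g. `t` and its partner `e t`) whose orbital integrands are supported on the SAME finite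
vertex set `SV`, with the SAME shell index `d`, representatives `r` and window `s`, and a shell decomposition through EACH centraliser,
`∫_G f(y γ y⁻¹) dν − ∫_G f(y γ′ y⁻¹) dν = Σ_{i ∈ s} #{x ∈ SV | d x = i} • (∫_K f(k⁻¹ (r_i⁻¹ γ r_i) k) dν − ∫_K f(k⁻¹ (r_i⁻¹ γ′ r_i) k) dν)`.
[cite: LabesseLanglands1979, §2 p. 8] [cite: Rogawski1990, §4.9 p. 54] -/
theorem integral_conj_sub_integral_conj_eq_sum_ncard_shell_smul_sub_of_vertexAction_haar (hK : IsOpen (K : Set G)) (γ γ' : G) (f : G → E)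
    (hF : Integrable (fun y : G => f (y⁻¹ * γ * y)) ν) (hF' : Integrable (fun y : G => f (y⁻¹ * γ' * y)) ν)
    {SV : Set W} (hSV : SV.Finite)
    (hsupp : ∀ y : G, f (y⁻¹ * γ * y) ≠ 0 → act y x₀ ∈ SV) (hsupp' : ∀ y : G, f (y⁻¹ * γ' * y) ≠ 0 → act y x₀ ∈ SV)
    {ι : Type*} (d : W → ι) (r : ι → G) (s : Finset ι)
    (hshell : ∀ x ∈ SV, ∃ t : G, t * γ = γ * t ∧ act (t * r (d x)) x₀ = x)
    (hshell' : ∀ x ∈ SV, ∃ t : G, t * γ' = γ' * t ∧ act (t * r (d x)) x₀ = x) (hs : ∀ x ∈ SV, d x ∈ s) :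
    (∫ y, f (y * γ * y⁻¹) ∂ν) - ∫ y, f (y * γ' * y⁻¹) ∂ν =
      ∑ i ∈ s, {x ∈ SV | d x = i}.ncard •
        ((∫ k in (K : Set G), f (k⁻¹ * ((r i)⁻¹ * γ * r i) * k) ∂ν) - ∫ k in (K : Set G), f (k⁻¹ * ((r i)⁻¹ * γ' * r i) * k) ∂ν) := by
  rw [integral_conj_eq_sum_ncard_shell_smul_of_vertexAction_haar ν K act act_one act_mul hV hKv γ hK f hF hSV hsupp d r s hshell hs,
    integral_conj_eq_sum_ncard_shell_smul_of_vertexAction_haar ν K act act_one act_mul hV hKv γ' hK f hF' hSV hsupp' d r s hshell' hs,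
    ← Finset.sum_sub_distrib]
  exact Finset.sum_congr rfl fun i _ => (smul_sub _ _ _).symm

end Difference

end Literature.NumberTheory.Automorphic

end
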